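import Summits.QuantumFields.YangMills.Theorems.BalabanUVNodesN15TorusTranslations
import Literature.MathematicalPhysics.QuantumFieldTheory.Balaban1983to89.B6Prop26Gluing
import HarnessLib

/-!
# Route «BalabanUVNodes» (K3⁷), node N15 = NE2, -a lane, PROGRAMME N file N-IIIa: THE NEUMANN-BY-IMAGES CUBE PROPAGATOR OF [B6] (2.37) AT `U ≡ 1`
# ON KING's TORUS CARRIER AND ITS EXACT PER-CUBE LOCALITY `M_h ∘ Δ_a ∘ G(□) = M_h`

Cell `pub-ymgap`, seat `pub-ymgap-dag-n15-a` (KNIT-BY-NAME, g19; D-0062; chair R424 venue; `bears_on: R4∕N15`); `--kind proof --supports stmt-QuantumFields-20544 --as helper`.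
Sequel of N-Ia∕N-Ib∕N-Ic (`…N15TorusReflections`, `…DeltaA`, `…N15TorusTranslations`).  CONSUMER: dag-n15-c's two-spacing gluing (`…N15TwoSpacingGluing`, `…GluingDefect`,
`…GluingCubes` FILE 45 `lap_comp_parametrix (hloc : ∀ i, mulOp (h i) ∘ₗ Δ ∘ₗ G i = mulOp (h i))`, `…GluingCommutator`; interface agreed on the pub-ymgap bus INBOX l.26902∕l.27050:
«(L1)∕(L1ᵀ) it is, `G_□` abstract»).

PRINT.  [Balaban1984PropagatorsII] (2.37) p. 229: «`G′(□)` … an inverse of `Δ′_a` with some boundary conditions on the boundary of `□`, e.g. with Neumann boundary conditions as in [3]».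
OBJECT (MODEL LEVEL: `U ≡ 1`, Bałaban's Landau-gauge `Δ_a` of [Balaban1984PropagatorsI] (1.69) on `T_η = Tor (fine n M)` with `M_ν = 2S` — the DOUBLED cube — and `G = gOp M n a`).
The cube `□ + c` = the points `0 ≤ x_ν − nc_ν < Sn`; its INTERIOR BONDS `χ°` = its bonds except the seam bonds `x_μ − nc_μ = Sn − 1` of their own direction (self-mirror).  §7: the
multi-reflections `R_T = reflSet M n c T` (`T ⊆ {0,…,d}`, bond twist), `R_∅ = 1`, `R_{{κ}} = reflVRAt`, ★ `R_κ ∘ R_T = R_{T∪{κ}}`, ★★ `R_T ∘ G = G ∘ R_T`, the symmetriser `Sym = Σ_T R_T`,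
`Sym ∘ G = G ∘ Sym`.  §8: ★ `not_intBond_imgBond` — THE CUBE IS A FUNDAMENTAL DOMAIN (`val(−1 − z) ≥ Sn`, `val(−2 − z) ≥ Sn` in `ℤ∕2Sn`), ★★ `χ° ∘ Sym ∘ χ° = χ°`, the cube propagators
**`neumannCubeG := Sym ∘ G ∘ χ°`**, **`neumannCubeGL := χ° ∘ G ∘ Sym`**, ★★★ **`mulOp_comp_deltaOp_comp_neumannCubeG`**: `M_h ∘ Δ_a ∘ G(□) = M_h` for every `h` supported on the interior
bonds (dag-n15-c's `hloc` VERBATIM), ★★★ `neumannCubeGL_comp_deltaOp_comp_mulOp` (left form).  The gluing LETTERS (block majorants, two-grid defects) are the sequel N-IIIb.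
HONEST FRAMING.  Finite-dimensional lattice algebra over N-Ib∕N-Ic's equivariance; no estimate; `U ≡ 1` torus MODEL of [B5] §1 with the doubled-cube torus; Neumann-by-images is
print's named choice ((2.37) «e.g.»), NOT the multiscale `G(Ω)` of record; nothing of [B6] (2.38)–(2.40)'s estimates asserted; N15 NOT discharged (object-bound; NE2⁺ NOT PRINTED);
counts UNMOVED (typed 28∕28 · discharged 5∕27); one finite torus — NOT continuum ∕ ℝ⁴ ∕ OS ∕ mass gap ∕ Clay.  Plumbing defs are DATA (`imgPt`, `imgBond`, `sgnT`, `reflSet`, `symOp`,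
`intBonds` (a `Finset`), `chiInt`, `neumannCubeG`, `neumannCubeGL`).
-/

noncomputable section

open scoped BigOperators Matrix ComplexConjugate
open Finset

namespace Summit.QuantumFields.YangMills.BalabanUVNodes.N15.TwoGrid

open Literature.MathematicalPhysics.QuantumFieldTheory.Balaban1983to89
open Literature.MathematicalPhysics.QuantumFieldTheory.Balaban1983to89.B5Prop11Plancherel (Tor fine unitVec shiftM fdiff)
open Literature.MathematicalPhysics.QuantumFieldTheory.Balaban1983to89.B5Block118 (tstep up upHom iota bpt lineSum QsOp QvOp QsOp_mulVec QvOp_mulVec tstep_succ)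
open Literature.MathematicalPhysics.QuantumFieldTheory.Balaban1983to89.B5Action121 (shiftS sdiff sdiff_mulVec GradOp GradOp_mulVec LapS LapS_mulVec LapV)
open Literature.MathematicalPhysics.QuantumFieldTheory.Balaban1983to89.B5Prop11Lower (Lap)
open Literature.MathematicalPhysics.QuantumFieldTheory.Balaban1983to89.B5LaplaceInverse (LapSinv Pker LapS_mul_LapSinv LapSinv_mul_LapS LapSinv_mul_Pker
  Pker_mul_LapSinv Pker_const Pker_orth)
open Literature.MathematicalPhysics.QuantumFieldTheory.Balaban1983to89.B5Substitution125 (Mop Cavg Kmat Minv Kmat_isUnit)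
open Literature.MathematicalPhysics.QuantumFieldTheory.Balaban1983to89.B5Projection127 (Pc)
open Literature.MathematicalPhysics.QuantumFieldTheory.Balaban1983to89.B5Value126 (PcT)
open Literature.MathematicalPhysics.QuantumFieldTheory.Balaban1983to89.B5DeltaA169 (DeltaA QvAdj isUnit_DeltaA)
open Literature.MathematicalPhysics.QuantumFieldTheory.Balaban1983to89.B5RealFields (IsReal reM GR DeltaAR isReal_DeltaA)
open Literature.MathematicalPhysics.QuantumFieldTheory.Balaban1983to89.B6Prop26Gluing (mulOp mulOp_apply)
open Literature.MathematicalPhysics.QuantumFieldTheory.Balaban1983to89.T4EtaRateCoeffDefect (pull pull_apply)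

variable {d : ℕ}


/-! ## §7 THE NEUMANN-BY-IMAGES CUBE PROPAGATOR: multi-reflections in the faces of a block-aligned cube, the symmetriser, per-cube locality -/

section Images

variable (M : Fin (d + 1) → ℕ) [∀ μ, NeZero (M μ)] (n : ℕ) [NeZero n] (c : Tor M)

/-- the image of a POINT under the reflections in the lower faces `x_ν = nc_ν − ½` of the cube `□ + c` in the directions of `T`: `x_ν ↦ 2nc_ν − 1 − x_ν` (`ν ∈ T`). [folklore] -/
def imgPt (T : Finset (Fin (d + 1))) (x : Tor (fine n M)) : Tor (fine n M) :=
  fun ν => if ν ∈ T then 2 * up n M c ν - 1 - x ν else x ν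

/-- the image of a BOND (1-form index): the point image, with the bond twist (start point one step lower) when the bond's own direction is reflected.
[cite: Balaban1984PropagatorsI, (1.1) p.18 («A_{⟨x,x′⟩} = −A_{⟨x′,x⟩}»)] -/
def imgBond (T : Finset (Fin (d + 1))) (b : Tor (fine n M) × Fin (d + 1)) : Tor (fine n M) × Fin (d + 1) :=
  (imgPt M n c T b.1 - (if b.2 ∈ T then unitVec (fine n M) b.2 else 0), b.2)

/-- the sign of the multi-reflection on a bond: `−1` iff the bond's own direction is reflected. [folklore] -/
def sgnT (T : Finset (Fin (d + 1))) (b : Tor (fine n M) × Fin (d + 1)) : ℝ := if b.2 ∈ T then -1 else 1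

/-- **THE MULTI-REFLECTION `R_T`** of real 1-forms in the lower faces of `□ + c` in the directions `T ⊆ {0,…,d}` (signed pull-back). [cite: Balaban1984PropagatorsII, (2.37) p.229 (Neumann cubes by reflection, as in [3])] -/
def reflSet (T : Finset (Fin (d + 1))) : (Tor (fine n M) × Fin (d + 1) → ℝ) →ₗ[ℝ] (Tor (fine n M) × Fin (d + 1) → ℝ) :=
  mulOp (sgnT M n T) ∘ₗ pull (imgBond M n c T)

variable {M n c}

omit [∀ μ, NeZero (M μ)] [NeZero n] in
/-- `(R_T A)(b) = ε_T(b)·A(img_T b)`. [folklore] -/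
theorem reflSet_apply (T : Finset (Fin (d + 1))) (A : Tor (fine n M) × Fin (d + 1) → ℝ) (b : Tor (fine n M) × Fin (d + 1)) :
    reflSet M n c T A b = sgnT M n T b * A (imgBond M n c T b) := by
  rw [reflSet, LinearMap.comp_apply, mulOp_apply, pull_apply]

omit [∀ μ, NeZero (M μ)] [NeZero n] in
/-- `img_∅ = id` on points. [folklore] -/
theorem imgPt_empty (x : Tor (fine n M)) : imgPt M n c ∅ x = x := by
  funext ν; simp [imgPt]

omit [∀ μ, NeZero (M μ)] [NeZero n] in
/-- `R_∅ = 1`. [folklore] -/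
theorem reflSet_empty : reflSet M n c (∅ : Finset (Fin (d + 1))) = LinearMap.id := by
  refine LinearMap.ext fun A => funext fun b => ?_
  rw [reflSet_apply, LinearMap.id_apply]
  simp [sgnT, imgBond, imgPt_empty]

/-- the one-face reflection of N-Ic IS `R_{{κ}}`. [folklore] -/
theorem reflVRAt_apply_eq (κ : Fin (d + 1)) (A : Tor (fine n M) × Fin (d + 1) → ℝ) (b : Tor (fine n M) × Fin (d + 1)) :
    reflVRAt M n c κ A b = reflSet M n c {κ} A b := by
  obtain ⟨x, μ⟩ := b
  rw [reflVRAt_apply, tshiftV_apply, reflSet_apply]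
  have hpt : torRefl (fine n M) κ (x + -up n M c) + up n M c = imgPt M n c {κ} x := by
    funext ν; by_cases h : ν = κ
    · subst h; simp only [torRefl_apply_same, Pi.add_apply, Pi.neg_apply, imgPt, Finset.mem_singleton, if_true]; ring
    · simp [imgPt, h]
  by_cases h : μ = κ
  · subst h
    rw [reflVR_apply_same, tshiftV_apply]
    simp only [sgnT, imgBond, Finset.mem_singleton, if_true]
    rw [show torRefl (fine n M) μ (x + -up n M c) - unitVec (fine n M) μ + up n M c = imgPt M n c {μ} x - unitVec (fine n M) μ by rw [← hpt]; abel]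
    ring
  · rw [reflVR_apply_ne _ _ h, tshiftV_apply]
    simp only [sgnT, imgBond, Finset.mem_singleton, if_neg h, hpt, sub_zero, one_mul]

/-- the one-face reflection IS `R_{{κ}}` (operator form). [folklore] -/
theorem reflVRAt_eq_reflSet (κ : Fin (d + 1)) : reflVRAt M n c κ = reflSet M n c {κ} :=
  LinearMap.ext fun A => funext fun b => reflVRAt_apply_eq κ A b

omit [∀ μ, NeZero (M μ)] [NeZero n] in
/-- composing images: `img_{{κ}}` then `img_T` is `img_{T ∪ {κ}}` on points when `κ ∉ T`. [folklore] -/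
theorem imgPt_imgPt (κ : Fin (d + 1)) {T : Finset (Fin (d + 1))} (hκ : κ ∉ T) (x : Tor (fine n M)) :
    imgPt M n c T (imgPt M n c {κ} x) = imgPt M n c (insert κ T) x := by
  funext ν
  by_cases h1 : ν = κ
  · subst h1; simp [imgPt, hκ]
  · by_cases h2 : ν ∈ T
    · simp [imgPt, h1, h2]
    · simp [imgPt, h1, h2]

omit [∀ μ, NeZero (M μ)] [NeZero n] in
/-- `img_T` is affine with linear part `−1` on the reflected coordinates: `img_T(x − v) = img_T x + (reflected part of v) − (rest of v)`; the case used below. [folklore] -/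
theorem imgPt_sub_unitVec_of_not_mem {T : Finset (Fin (d + 1))} {μ : Fin (d + 1)} (hμ : μ ∉ T) (x : Tor (fine n M)) :
    imgPt M n c T (x - unitVec (fine n M) μ) = imgPt M n c T x - unitVec (fine n M) μ := by
  funext ν
  by_cases h : ν ∈ T
  · have hne : ν ≠ μ := fun h' => hμ (h' ▸ h)
    simp [imgPt, h, unitVec, Pi.single_eq_of_ne hne]
  · simp [imgPt, h]

omit [∀ μ, NeZero (M μ)] [NeZero n] in
/-- `img_T(x − e_μ) = img_T x + e_μ` when `μ ∈ T` (the reflected coordinate flips the step). [folklore] -/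
theorem imgPt_sub_unitVec_of_mem {T : Finset (Fin (d + 1))} {μ : Fin (d + 1)} (hμ : μ ∈ T) (x : Tor (fine n M)) :
    imgPt M n c T (x - unitVec (fine n M) μ) = imgPt M n c T x + unitVec (fine n M) μ := by
  funext ν
  by_cases h : ν = μ
  · subst h; simp only [imgPt, if_pos hμ, Pi.sub_apply, Pi.add_apply, unitVec, Pi.single_eq_same]; ring
  · by_cases h2 : ν ∈ T
    · simp [imgPt, h2, unitVec, Pi.single_eq_of_ne h]
    · simp [imgPt, h2, unitVec, Pi.single_eq_of_ne h]

/-- ★ `R_κ ∘ R_T = R_{T ∪ {κ}}` for `κ ∉ T` (reflections in different faces commute and compose coordinatewise; the bond twists add up). [folklore] -/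
theorem reflVRAt_comp_reflSet (κ : Fin (d + 1)) {T : Finset (Fin (d + 1))} (hκ : κ ∉ T) :
    reflVRAt M n c κ ∘ₗ reflSet M n c T = reflSet M n c (insert κ T) := by
  refine LinearMap.ext fun A => funext fun b => ?_
  obtain ⟨x, μ⟩ := b
  rw [LinearMap.comp_apply, reflVRAt_apply_eq, reflSet_apply, reflSet_apply, reflSet_apply]
  simp only [sgnT, imgBond, Finset.mem_singleton, Finset.mem_insert]
  by_cases hμκ : μ = κ
  · subst hμκ
    have hμT : μ ∉ T := hκ
    simp only [if_true, if_neg hμT, true_or, sub_zero]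
    rw [imgPt_sub_unitVec_of_not_mem hμT, imgPt_imgPt μ hμT]
    ring
  · have e1 : (if μ = κ ∨ μ ∈ T then (-1 : ℝ) else 1) = (if μ ∈ T then (-1 : ℝ) else 1) := by simp [hμκ]
    have e2 : (if μ = κ ∨ μ ∈ T then unitVec (fine n M) μ else (0 : Tor (fine n M))) = (if μ ∈ T then unitVec (fine n M) μ else 0) := by simp [hμκ]
    rw [e1, e2, if_neg hμκ, if_neg hμκ, sub_zero, one_mul, imgPt_imgPt κ hκ]

variable (M n c) (a : ℝ)

/-- ★★ **`R_T ∘ G = G ∘ R_T`** for every set of directions (induction on `T` from N-Ic's one-face statement). [cite: Balaban1984PropagatorsII, (2.37) p.229] -/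
theorem reflSet_comp_gOp (hn : 1 ≤ n) (ha : 0 < a) (T : Finset (Fin (d + 1))) : reflSet M n c T ∘ₗ gOp M n a = gOp M n a ∘ₗ reflSet M n c T := by
  induction T using Finset.induction_on with
  | empty => rw [reflSet_empty, LinearMap.id_comp, LinearMap.comp_id]
  | @insert κ T hκ ih =>
      rw [← reflVRAt_comp_reflSet κ hκ, LinearMap.comp_assoc, ih, ← LinearMap.comp_assoc, reflVRAt_comp_gOp M n c a κ hn ha, LinearMap.comp_assoc]

/-- `R_T ∘ Δ_a = Δ_a ∘ R_T`. [folklore] -/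
theorem reflSet_comp_deltaOp (T : Finset (Fin (d + 1))) : reflSet M n c T ∘ₗ deltaOp M n a = deltaOp M n a ∘ₗ reflSet M n c T := by
  induction T using Finset.induction_on with
  | empty => rw [reflSet_empty, LinearMap.id_comp, LinearMap.comp_id]
  | @insert κ T hκ ih =>
      rw [← reflVRAt_comp_reflSet κ hκ, LinearMap.comp_assoc, ih, ← LinearMap.comp_assoc, reflVRAt_comp_deltaOp M n c a κ, LinearMap.comp_assoc]

/-- **THE SYMMETRISER** `Sym_c = Σ_{T ⊆ {0,…,d}} R_T` of the cube `□ + c` (sum over the `2^{d+1}` images). [cite: Balaban1984PropagatorsII, (2.37) p.229 (method of images)] -/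
def symOp : (Tor (fine n M) × Fin (d + 1) → ℝ) →ₗ[ℝ] (Tor (fine n M) × Fin (d + 1) → ℝ) :=
  ∑ T ∈ (Finset.univ : Finset (Fin (d + 1))).powerset, reflSet M n c T

variable {M n c a}

omit [∀ μ, NeZero (M μ)] [NeZero n] in
/-- `(Sym f)(b) = Σ_T ε_T(b) f(img_T b)`. [folklore] -/
theorem symOp_apply (f : Tor (fine n M) × Fin (d + 1) → ℝ) (b : Tor (fine n M) × Fin (d + 1)) :
    symOp M n c f b = ∑ T ∈ (Finset.univ : Finset (Fin (d + 1))).powerset, sgnT M n T b * f (imgBond M n c T b) := by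
  rw [symOp, LinearMap.sum_apply, Finset.sum_apply]
  simp only [reflSet_apply]

variable (M n c a)

/-- ★★ **`Sym ∘ G = G ∘ Sym`**. [folklore] -/
theorem symOp_comp_gOp (hn : 1 ≤ n) (ha : 0 < a) : symOp M n c ∘ₗ gOp M n a = gOp M n a ∘ₗ symOp M n c := by
  refine LinearMap.ext fun f => ?_
  rw [LinearMap.comp_apply, LinearMap.comp_apply, symOp, LinearMap.sum_apply, LinearMap.sum_apply, map_sum]
  refine Finset.sum_congr rfl fun T _ => ?_
  exact LinearMap.congr_fun (reflSet_comp_gOp M n c a hn ha T) f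

/-- `Sym ∘ Δ_a = Δ_a ∘ Sym`. [folklore] -/
theorem symOp_comp_deltaOp : symOp M n c ∘ₗ deltaOp M n a = deltaOp M n a ∘ₗ symOp M n c := by
  refine LinearMap.ext fun f => ?_
  rw [LinearMap.comp_apply, LinearMap.comp_apply, symOp, LinearMap.sum_apply, LinearMap.sum_apply, map_sum]
  refine Finset.sum_congr rfl fun T _ => ?_
  exact LinearMap.congr_fun (reflSet_comp_deltaOp M n c a T) f

end Images

/-! ## §8 The cube as a fundamental domain: interior bonds, `χ°·Sym·χ° = χ°`, the cube propagator and ITS PER-CUBE LOCALITY -/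

section Cube

variable (M : Fin (d + 1) → ℕ) [∀ μ, NeZero (M μ)] (n : ℕ) [NeZero n] (c : Tor M) (S : ℕ)

/-- **THE INTERIOR BONDS of the block-aligned cube `□ + c` of side `S` blocks** (a `Finset`): the bonds `(x, μ)` with `0 ≤ x_ν − nc_ν < Sn` in every direction (the cube's
points, [Balaban1984PropagatorsII] p. 229 «cubes □ … a sum of … big blocks») that do not cross the upper mirror of their own direction (`x_μ − nc_μ ≠ Sn − 1`: the seam bonds are their
own mirror images and are excluded). [cite: Balaban1984PropagatorsII, (2.37) p.229 (the cubes of the cover)] -/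
def intBonds : Finset (Tor (fine n M) × Fin (d + 1)) :=
  Finset.univ.filter fun b => (∀ ν, (b.1 ν - up n M c ν).val < S * n) ∧ (b.1 b.2 - up n M c b.2).val ≠ S * n - 1

/-- the indicator `χ°` of the interior bonds. [folklore] -/
def chiInt (b : Tor (fine n M) × Fin (d + 1)) : ℝ := if b ∈ intBonds M n c S then 1 else 0

variable {M n c S}

/-- membership in the interior bonds, unfolded. [folklore] -/
theorem mem_intBonds (b : Tor (fine n M) × Fin (d + 1)) :
    b ∈ intBonds M n c S ↔ (∀ ν, (b.1 ν - up n M c ν).val < S * n) ∧ (b.1 b.2 - up n M c b.2).val ≠ S * n - 1 := by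
  simp [intBonds]

/-- `χ° ∈ {0, 1}`, hence `|χ°| ≤ 1`. [folklore] -/
theorem abs_chiInt_le_one (b : Tor (fine n M) × Fin (d + 1)) : |chiInt M n c S b| ≤ 1 := by
  unfold chiInt; split_ifs <;> simp

/-- `χ°·χ° = χ°`. [folklore] -/
theorem chiInt_mul_self (b : Tor (fine n M) × Fin (d + 1)) : chiInt M n c S b * chiInt M n c S b = chiInt M n c S b := by
  unfold chiInt; split_ifs <;> simp

/-- `χ° = 1` on interior bonds. [folklore] -/
theorem chiInt_of_intBond {b : Tor (fine n M) × Fin (d + 1)} (h : b ∈ intBonds M n c S) : chiInt M n c S b = 1 := by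
  unfold chiInt; rw [if_pos h]

/-- `χ° = 0` off the interior bonds. [folklore] -/
theorem chiInt_of_not_intBond {b : Tor (fine n M) × Fin (d + 1)} (h : b ∉ intBonds M n c S) : chiInt M n c S b = 0 := by
  unfold chiInt; rw [if_neg h]

/-- in `ℤ∕(2B)`: if `val z < B` then `val(−1 − z) ≥ B` (the mirror image of a cube coordinate leaves the cube). [folklore] -/
theorem le_val_neg_one_sub {N : ℕ} [NeZero N] (z : ZMod N) {B : ℕ} (hz : z.val < B) (hN : N = 2 * B) : B ≤ (-1 - z).val := by
  have hNpos : 0 < N := Nat.pos_of_ne_zero (NeZero.ne N)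
  have h1 : ((-1 : ZMod N)) = ((N - 1 : ℕ) : ZMod N) := by
    rw [Nat.cast_sub hNpos, Nat.cast_one, ZMod.natCast_self, zero_sub]
  have hv : (((N - 1 : ℕ) : ZMod N)).val = N - 1 := ZMod.val_natCast_of_lt (Nat.sub_lt hNpos Nat.one_pos)
  have hzN : z.val < N := ZMod.val_lt z
  rw [h1, ZMod.val_sub (by rw [hv]; omega), hv]
  omega

/-- in `ℤ∕(2B)`: if `val z < B` and `val z ≠ B − 1` then `val(−2 − z) ≥ B` (the twisted image of an interior bond in its own direction leaves the cube). [folklore] -/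
theorem le_val_neg_two_sub {N : ℕ} [NeZero N] (z : ZMod N) {B : ℕ} (hz : z.val < B) (hne : z.val ≠ B - 1) (hN : N = 2 * B) : B ≤ (-2 - z).val := by
  have hNpos : 0 < N := Nat.pos_of_ne_zero (NeZero.ne N)
  have hB : 1 ≤ B := by omega
  have h1 : ((-2 : ZMod N)) = ((N - 2 : ℕ) : ZMod N) := by
    rw [Nat.cast_sub (by omega), ZMod.natCast_self, zero_sub]; norm_num
  have hv : (((N - 2 : ℕ) : ZMod N)).val = N - 2 := ZMod.val_natCast_of_lt (by omega)
  rw [h1, ZMod.val_sub (by rw [hv]; omega), hv]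
  omega

/-- ★ **THE CUBE IS A FUNDAMENTAL DOMAIN**: an interior bond reflected in a nonempty set of faces is NOT an interior bond (indeed not in the cube, or the excluded seam).
Requires the torus to be the DOUBLED cube: `M_ν = 2S` in every direction. [cite: Balaban1984PropagatorsII, (2.37) p.229 (method of images)] -/
theorem not_intBond_imgBond (hM : ∀ ν, M ν = 2 * S) {T : Finset (Fin (d + 1))} (hT : T.Nonempty) {b : Tor (fine n M) × Fin (d + 1)}
    (hb' : b ∈ intBonds M n c S) : imgBond M n c T b ∉ intBonds M n c S := by
  rw [mem_intBonds] at hb' ⊢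
  have hb := hb'
  obtain ⟨x, μ⟩ := b
  obtain ⟨ν, hν⟩ := hT
  have hNν : fine n M ν = 2 * (S * n) := by show n * M ν = _; rw [hM ν]; ring
  intro himg
  have hcube := himg.1 ν
  simp only [imgBond] at hcube
  by_cases hνμ : ν = μ
  · subst hνμ
    -- the bond's own direction is reflected: image coordinate `2nc − 2 − x`, value `2Sn − 2 − t`
    simp only [if_pos hν, imgPt, Pi.sub_apply] at hcube
    have ht : (x ν - up n M c ν).val < S * n := hb.1 ν
    have hne : (x ν - up n M c ν).val ≠ S * n - 1 := hb.2
    have key : (2 * up n M c ν - 1 - x ν - unitVec (fine n M) ν ν - up n M c ν) = -2 - (x ν - up n M c ν) := by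
      simp only [unitVec, Pi.single_eq_same]; ring
    rw [key] at hcube
    exact absurd hcube (not_lt.mpr (le_val_neg_two_sub _ ht hne hNν))
  · -- another direction is reflected: image coordinate `2nc − 1 − x`, value `2Sn − 1 − t ≥ Sn`
    have hpt : (imgPt M n c T x - (if μ ∈ T then unitVec (fine n M) μ else 0)) ν = 2 * up n M c ν - 1 - x ν := by
      simp only [Pi.sub_apply, imgPt, if_pos hν]
      split_ifs with h
      · simp [unitVec, Pi.single_eq_of_ne hνμ]
      · simp
    rw [hpt] at hcube
    have ht : (x ν - up n M c ν).val < S * n := hb.1 ν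
    have key : (2 * up n M c ν - 1 - x ν - up n M c ν) = -1 - (x ν - up n M c ν) := by ring
    rw [key] at hcube
    exact absurd hcube (not_lt.mpr (le_val_neg_one_sub _ ht hNν))

/-- `χ°(img_T b)·χ°(b) = 0` for `T ≠ ∅`. [folklore] -/
theorem chiInt_imgBond_mul_chiInt (hM : ∀ ν, M ν = 2 * S) {T : Finset (Fin (d + 1))} (hT : T.Nonempty) (b : Tor (fine n M) × Fin (d + 1)) :
    chiInt M n c S (imgBond M n c T b) * chiInt M n c S b = 0 := by
  by_cases hb : b ∈ intBonds M n c S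
  · rw [chiInt_of_not_intBond (not_intBond_imgBond hM hT hb), zero_mul]
  · rw [chiInt_of_not_intBond hb, mul_zero]

variable (M n c S)

/-- ★★ **`χ° ∘ Sym ∘ χ° = χ°`**: on the interior bonds only the identity image survives. [cite: Balaban1984PropagatorsII, (2.37) p.229 (method of images)] -/
theorem mulOp_chi_symOp_mulOp_chi (hM : ∀ ν, M ν = 2 * S) :
    mulOp (chiInt M n c S) ∘ₗ symOp M n c ∘ₗ mulOp (chiInt M n c S) = mulOp (chiInt M n c S) := by
  refine LinearMap.ext fun f => funext fun b => ?_
  rw [LinearMap.comp_apply, LinearMap.comp_apply, mulOp_apply, symOp_apply, mulOp_apply,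
    ← Finset.add_sum_erase _ _ (Finset.empty_mem_powerset _)]
  have h0 : sgnT M n (∅ : Finset (Fin (d + 1))) b * mulOp (chiInt M n c S) f (imgBond M n c ∅ b) = chiInt M n c S b * f b := by
    simp [sgnT, imgBond, imgPt_empty, mulOp_apply]
  have hrest : ∑ T ∈ ((Finset.univ : Finset (Fin (d + 1))).powerset).erase ∅, sgnT M n T b * mulOp (chiInt M n c S) f (imgBond M n c T b) =
      ∑ T ∈ ((Finset.univ : Finset (Fin (d + 1))).powerset).erase ∅, sgnT M n T b * (chiInt M n c S (imgBond M n c T b) * f (imgBond M n c T b)) := by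
    simp only [mulOp_apply]
  rw [h0, hrest, mul_add, Finset.mul_sum]
  have hzero : ∑ T ∈ ((Finset.univ : Finset (Fin (d + 1))).powerset).erase ∅, chiInt M n c S b * (sgnT M n T b * (chiInt M n c S (imgBond M n c T b) * f (imgBond M n c T b))) = 0 := by
    refine Finset.sum_eq_zero fun T hT => ?_
    have hne : T.Nonempty := Finset.nonempty_iff_ne_empty.mpr (Finset.ne_of_mem_erase hT)
    have := chiInt_imgBond_mul_chiInt (n := n) (c := c) hM hne b
    calc chiInt M n c S b * (sgnT M n T b * (chiInt M n c S (imgBond M n c T b) * f (imgBond M n c T b)))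
        = sgnT M n T b * f (imgBond M n c T b) * (chiInt M n c S (imgBond M n c T b) * chiInt M n c S b) := by ring
      _ = 0 := by rw [this, mul_zero]
  rw [hzero, add_zero, ← mul_assoc, chiInt_mul_self]

variable (a : ℝ)

/-- **THE NEUMANN-BY-IMAGES CUBE PROPAGATOR** `G(□ + c) := Sym_c ∘ G ∘ χ°_c` (right-compressed: sources on the interior bonds of the cube, symmetrised over the `2^{d+1}` images,
propagated by the TORUS propagator `G = Δ_a⁻¹`). [cite: Balaban1984PropagatorsII, (2.37) p.229 («G′(□) … an inverse of Δ′_a with … e.g. Neumann boundary conditions as in [3]»)] -/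
def neumannCubeG : (Tor (fine n M) × Fin (d + 1) → ℝ) →ₗ[ℝ] (Tor (fine n M) × Fin (d + 1) → ℝ) :=
  symOp M n c ∘ₗ gOp M n a ∘ₗ mulOp (chiInt M n c S)

/-- the LEFT-compressed transpose arrangement `G^L(□ + c) := χ°_c ∘ G ∘ Sym_c` (for left parametrices). [cite: Balaban1984PropagatorsII, (2.91) p.239 (left parametrix)] -/
def neumannCubeGL : (Tor (fine n M) × Fin (d + 1) → ℝ) →ₗ[ℝ] (Tor (fine n M) × Fin (d + 1) → ℝ) :=
  mulOp (chiInt M n c S) ∘ₗ gOp M n a ∘ₗ symOp M n c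

/-- ★★★ **PER-CUBE LOCALITY, EXACT**: `χ° ∘ Δ_a ∘ G(□) = χ°` — on the interior of the cube the images propagator inverts the TORUS operator `Δ_a` (`M_ν = 2S`, `n ≥ 1`, `a > 0`).
[cite: Balaban1984PropagatorsII, (2.37)–(2.38) p.229] -/
theorem mulOp_chi_deltaOp_neumannCubeG (hM : ∀ ν, M ν = 2 * S) (hn : 1 ≤ n) (ha : 0 < a) :
    mulOp (chiInt M n c S) ∘ₗ deltaOp M n a ∘ₗ neumannCubeG M n c S a = mulOp (chiInt M n c S) := by
  refine LinearMap.ext fun f => ?_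
  have h1 := LinearMap.congr_fun (symOp_comp_deltaOp M n c a) (gOp M n a (mulOp (chiInt M n c S) f))
  have h2 := LinearMap.congr_fun (deltaOp_comp_gOp M n a hn ha) (mulOp (chiInt M n c S) f)
  have h3 := LinearMap.congr_fun (mulOp_chi_symOp_mulOp_chi M n c S hM) f
  simp only [LinearMap.comp_apply, LinearMap.id_apply] at h1 h2 h3 ⊢
  rw [neumannCubeG, LinearMap.comp_apply, LinearMap.comp_apply, ← h1, h2, h3]

/-- ★★★ **THE GLUING's LOCALITY HYPOTHESIS (L1)** `M_h ∘ Δ_a ∘ G(□) = M_h` for every multiplier `h` supported on the interior bonds of `□ + c` (dag-n15-c FILE 45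
`lap_comp_parametrix`'s `hloc`). [cite: Balaban1984PropagatorsII, (2.38) p.229] -/
theorem mulOp_comp_deltaOp_comp_neumannCubeG (hM : ∀ ν, M ν = 2 * S) (hn : 1 ≤ n) (ha : 0 < a) {h : Tor (fine n M) × Fin (d + 1) → ℝ}
    (hh : ∀ b, h b ≠ 0 → b ∈ intBonds M n c S) : mulOp h ∘ₗ deltaOp M n a ∘ₗ neumannCubeG M n c S a = mulOp h := by
  refine LinearMap.ext fun f => funext fun b => ?_
  have h0 := congrFun (LinearMap.congr_fun (mulOp_chi_deltaOp_neumannCubeG M n c S a hM hn ha) f) b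
  simp only [LinearMap.comp_apply, mulOp_apply] at h0 ⊢
  by_cases hb : h b = 0
  · rw [hb, zero_mul, zero_mul]
  · rw [chiInt_of_intBond (hh b hb), one_mul, one_mul] at h0
    rw [h0]

/-- ★★★ **(L1ᵀ) for left parametrices**: `G^L(□) ∘ Δ_a ∘ χ° = χ°`. [cite: Balaban1984PropagatorsII, (2.91) p.239] -/
theorem neumannCubeGL_deltaOp_mulOp_chi (hM : ∀ ν, M ν = 2 * S) (hn : 1 ≤ n) (ha : 0 < a) :
    neumannCubeGL M n c S a ∘ₗ deltaOp M n a ∘ₗ mulOp (chiInt M n c S) = mulOp (chiInt M n c S) := by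
  refine LinearMap.ext fun f => ?_
  have h1 := LinearMap.congr_fun (symOp_comp_deltaOp M n c a) (mulOp (chiInt M n c S) f)
  have h2 := LinearMap.congr_fun (gOp_comp_deltaOp M n a hn ha) (symOp M n c (mulOp (chiInt M n c S) f))
  have h3 := LinearMap.congr_fun (mulOp_chi_symOp_mulOp_chi M n c S hM) f
  simp only [LinearMap.comp_apply, LinearMap.id_apply] at h1 h2 h3 ⊢
  rw [neumannCubeGL, LinearMap.comp_apply, LinearMap.comp_apply, h1, h2, h3]

/-- (L1ᵀ) with a multiplier supported on the interior bonds: `G^L(□) ∘ Δ_a ∘ M_h = M_h`. [cite: Balaban1984PropagatorsII, (2.91) p.239] -/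
theorem neumannCubeGL_comp_deltaOp_comp_mulOp (hM : ∀ ν, M ν = 2 * S) (hn : 1 ≤ n) (ha : 0 < a) {h : Tor (fine n M) × Fin (d + 1) → ℝ}
    (hh : ∀ b, h b ≠ 0 → b ∈ intBonds M n c S) : neumannCubeGL M n c S a ∘ₗ deltaOp M n a ∘ₗ mulOp h = mulOp h := by
  have hfac : mulOp h = mulOp (chiInt M n c S) ∘ₗ mulOp h := by
    refine LinearMap.ext fun f => funext fun b => ?_
    rw [LinearMap.comp_apply, mulOp_apply, mulOp_apply, mulOp_apply]
    by_cases hb : h b = 0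
    · rw [hb, zero_mul, mul_zero]
    · rw [chiInt_of_intBond (hh b hb), one_mul]
  refine LinearMap.ext fun f => ?_
  have h0 := LinearMap.congr_fun (neumannCubeGL_deltaOp_mulOp_chi M n c S a hM hn ha) (mulOp h f)
  have hf := LinearMap.congr_fun hfac f
  simp only [LinearMap.comp_apply] at h0 hf ⊢
  rw [hf, h0]

end Cube



end Summit.QuantumFields.YangMills.BalabanUVNodes.N15.TwoGrid
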